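import Literature.AlgebraicGeometry.GaoUllmo2025.CMHodgeModel
import Mathlib.FieldTheory.PrimitiveElement
import HarnessLib

/-!
# Gao–Ullmo 2025, proof of Theorem 3.1: `|Hom(E, ℂ)| = [E : ℚ]` for a CM algebra; embeddings of `E^c` are automorphisms

Z. Gao, E. Ullmo, *Hodge cycles and quadratic relations between holomorphic periods on CM abelian varieties*,
J. Inst. Math. Jussieu **25** (2025) 215–249 = arXiv:2411.12249 [GaoUllmo2025], §2.1 and §3.1 (proof of Theorem 3.1,
second paragraph, art. p. 11, chunk p0012 L14 of the held published text `corpus:paper:galaxy-pdf-4667137180`):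
"Let `{u_1, …, u_r}` be a basis of `E^c` over `ℚ`, with `r = [E^c : ℚ]`. Set `f_j := Σ_{σ ∈ G} σ(u_j)[σP]` … Then
`σ(f_j) = f_j` for each `σ ∈ Gal(E^c/ℚ)`".  The two standing facts about the CM pair that this descent uses, made
explicit over the typed model of `Literature.AlgebraicGeometry.GaoUllmo2025.CMHodgeModel`:

* Stage A (`card_emb_eq_finrank`): for a CM algebra `E` (a finite product of number fields suffices),
  `|Hom(E, ℂ)| = [E : ℚ]` — the count implicit in "`Hom(E, ℂ) = Φ ⊔ Φ̄`", `|Φ| = g = dim A`, `[E : ℚ] = 2g` (§2.1);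
  via `Hom(∏ K_i, C) = ⊔_i Hom(K_i, C)` for fields `K_i`, `C` (`sigmaEmb`, `card_emb_pi`) and Mathlib's `AlgHom.card`.
* Stage B (`finiteDimensional_galoisClosure`, `autOfEmb`): `E^c ⊂ ℂ` is a number field (generated by the finitely
  many algebraic numbers `φ(b_m)`), and every embedding `ρ : E^c → ℂ` maps `E^c` onto itself (`restrictEmb`), i.e.
  IS an element `σ_ρ` of `G = Gal(E^c/ℚ)` followed by the inclusion (`galAct_autOfEmb`) — this is how the formal proof
  runs the printed sum over `σ ∈ G` as a sum over embeddings `ρ`, with no normality instance needed; `ρ` acts on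
  `Hom(E, ℂ)` by `φ ↦ ρ ∘ φ` (`embAct`), bijectively (`embAct_bijective`).

## References

* [GaoUllmo2025] Z. Gao, E. Ullmo, J. Inst. Math. Jussieu 25 (2025) 215–249 — §2.1 (art. p. 6–7), proof of
  Theorem 3.1 (art. p. 11).

## Provenance

Staged by the pub-hodgecm formalisation cell (lineage `pub-hodgecm-pohl`) under the LEAN-IN-TREE rule; supersedes
§§PiAlgHom, CardEmb, EmbAct, Closure of the standalone package's `HodgeCM/Literature/GaoUllmoTheorem31.lean` (gate
run 20), namespace `HodgeCM.GaoUllmo` ↦ `Literature.AlgebraicGeometry.GaoUllmo2025` (`embAct_injective` is proved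
here directly from the injectivity of `ρ`, so that this module does not depend on `GaloisSigns`).
-/

noncomputable section

open Module

attribute [local instance] Classical.propDecidable

namespace Literature.AlgebraicGeometry.GaoUllmo2025

/-! #### Stage A: `|Hom(E, ℂ)| = [E : ℚ]` for a CM algebra (algebra homomorphisms out of a finite product of fields) -/

section PiAlgHom

variable {ι : Type} [Fintype ι] {K : ι → Type} [∀ i, Field (K i)] [∀ i, Algebra ℚ (K i)]
variable {C : Type} [Field C] [Algebra ℚ C]

omit [Fintype ι] [∀ i, Algebra ℚ (K i)] in
/-- Distinct standard idempotents of `∏ K_i` are orthogonal. [folklore] -/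
theorem single_one_mul_single_one_of_ne {i j : ι} (hij : i ≠ j) :
    (Pi.single i 1 : (i : ι) → K i) * Pi.single j 1 = 0 := by
  ext k
  rw [Pi.mul_apply, Pi.zero_apply]
  by_cases hk : k = i
  · subst hk
    rw [Pi.single_eq_of_ne hij, mul_zero]
  · rw [Pi.single_eq_of_ne hk, zero_mul]

/-- An algebra homomorphism from a finite product of fields to a field is `1` on exactly one standard idempotent.
[folklore] -/
theorem exists_single_one (φ : ((i : ι) → K i) →ₐ[ℚ] C) :
    ∃ i, φ (Pi.single i 1) = 1 ∧ ∀ j, j ≠ i → φ (Pi.single j 1) = 0 := by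
  have hsum : ∑ i, φ (Pi.single i 1) = 1 := by
    rw [← map_sum]
    have : (∑ i, Pi.single i 1 : (i : ι) → K i) = 1 := by
      ext k; simp [Finset.sum_apply]
    rw [this]
    exact map_one φ
  obtain ⟨i, -, hi⟩ : ∃ i ∈ Finset.univ, φ (Pi.single i 1) ≠ 0 := by
    apply Finset.exists_ne_zero_of_sum_ne_zero
    rw [hsum]; exact one_ne_zero
  have horth : ∀ j, j ≠ i → φ (Pi.single j 1) * φ (Pi.single i 1) = 0 := by
    intro j hji
    rw [← map_mul, single_one_mul_single_one_of_ne hji, map_zero]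
  have hi1 : φ (Pi.single i 1) = 1 := by
    have h : φ (Pi.single i 1) * φ (Pi.single i 1) = φ (Pi.single i 1) * 1 := by
      rw [← map_mul, ← Pi.single_mul, mul_one, mul_one]
    exact mul_left_cancel₀ hi h
  refine ⟨i, hi1, fun j hj => ?_⟩
  have := horth j hj
  rwa [hi1, mul_one] at this

/-- The embedding `(i, ψ) ↦ ψ ∘ pr_i` of `⊔_i Hom(K_i, C)` into `Hom(∏ K_i, C)`. [folklore] -/
def sigmaEmb (x : Σ i, (K i →ₐ[ℚ] C)) : ((i : ι) → K i) →ₐ[ℚ] C :=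
  x.2.comp (Pi.evalAlgHom ℚ K x.1)

omit [Fintype ι] in
/-- `sigmaEmb (i, ψ) a = ψ (a i)`. [folklore] -/
@[simp] theorem sigmaEmb_apply (x : Σ i, (K i →ₐ[ℚ] C)) (a : (i : ι) → K i) :
    sigmaEmb x a = x.2 (a x.1) := rfl

omit [Fintype ι] in
/-- `sigmaEmb` is injective. [folklore] -/
theorem sigmaEmb_injective : Function.Injective (sigmaEmb (K := K) (C := C)) := by
  rintro ⟨i, ψ⟩ ⟨j, ψ'⟩ h
  have hij : i = j := by
    by_contra hij
    have := congrArg (fun f => f (Pi.single i 1)) h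
    simp only [sigmaEmb_apply, Pi.single_eq_same, map_one] at this
    rw [Pi.single_eq_of_ne' hij, map_zero] at this
    exact one_ne_zero this
  subst hij
  have hψ : ψ = ψ' := by
    ext x
    have := congrArg (fun f => f (Pi.single i x)) h
    simpa using this
  subst hψ
  rfl

/-- `sigmaEmb` is surjective: every `φ : ∏ K_i → C` factors through one projection. [folklore] -/
theorem sigmaEmb_surjective : Function.Surjective (sigmaEmb (K := K) (C := C)) := by
  intro φ
  obtain ⟨i, hi1, hi0⟩ := exists_single_one φ
  -- the `i`-th component of `φ` as a ring homomorphism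
  let ψr : K i →+* C :=
    { toFun := fun x => φ (Pi.single i x)
      map_one' := hi1
      map_mul' := fun x y => by
        show φ (Pi.single i (x * y)) = φ (Pi.single i x) * φ (Pi.single i y)
        rw [Pi.single_mul, map_mul]
      map_zero' := by simp
      map_add' := fun x y => by
        show φ (Pi.single i (x + y)) = φ (Pi.single i x) + φ (Pi.single i y)
        rw [Pi.single_add, map_add] }
  let ψ : K i →ₐ[ℚ] C := ψr.toRatAlgHom
  refine ⟨⟨i, ψ⟩, ?_⟩
  apply AlgHom.ext
  intro a
  rw [sigmaEmb_apply]
  show φ (Pi.single i (a i)) = φ a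
  have ha : a = ∑ j, Pi.single j (a j) := (Finset.univ_sum_single a).symm
  conv_rhs => rw [ha, map_sum]
  rw [Finset.sum_eq_single i]
  · intro j _ hji
    have : Pi.single j (a j) = Pi.single j (a j) * Pi.single j 1 := by
      rw [← Pi.single_mul, mul_one]
    rw [this, map_mul, hi0 j hji, mul_zero]
  · intro h; exact absurd (Finset.mem_univ i) h

/-- `|Hom(∏ K_i, C)| = Σ_i |Hom(K_i, C)|`. [folklore] -/
theorem card_emb_pi [∀ i, FiniteDimensional ℚ (K i)] :
    Fintype.card (((i : ι) → K i) →ₐ[ℚ] C) = ∑ i, Fintype.card (K i →ₐ[ℚ] C) := by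
  rw [← Fintype.card_sigma]
  exact (Fintype.card_of_bijective ⟨sigmaEmb_injective, sigmaEmb_surjective⟩).symm

end PiAlgHom

section CardEmb

variable {E : Type} [CommRing E] [Algebra ℚ E] [Module.Finite ℚ E]

/-- For a CM algebra, `|Hom(E, ℂ)| = [E : ℚ]` (§2.1: `Hom(E, ℂ) = Φ ⊔ Φ̄`, `|Φ| = g`, `[E : ℚ] = 2g`; by Stage A and
Mathlib's `AlgHom.card` for each CM field factor). [cite: GaoUllmo2025, §2.1] -/
theorem card_emb_eq_finrank (hE : IsCMAlgebra E) : Fintype.card (Emb E) = finrank ℚ E := by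
  obtain ⟨ι, _, K, _, _, _, ⟨e⟩⟩ := hE
  have h1 : Fintype.card (Emb E) = Fintype.card (((i : ι) → K i) →ₐ[ℚ] ℂ) :=
    Fintype.card_congr (AlgEquiv.arrowCongr e AlgEquiv.refl)
  rw [h1, card_emb_pi, ← e.toLinearEquiv.finrank_eq.symm, Module.finrank_pi_fintype]
  refine Finset.sum_congr rfl fun i _ => ?_
  exact AlgHom.card ℚ (K i) ℂ

end CardEmb

/-! #### Stage B: `E^c` is a number field; embeddings `ρ : E^c → ℂ` restrict to automorphisms of `E^c` -/

section EmbAct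

variable {E : Type} [CommRing E] [Algebra ℚ E]

/-- The action of an embedding `ρ : E^c → ℂ` on `Hom(E, ℂ)`: `φ ↦ ρ ∘ φ`. [folklore] -/
def embAct (ρ : galoisClosure E →ₐ[ℚ] ℂ) (φ : Emb E) : Emb E := ρ.comp (corestrict E φ)

/-- `(ρ · φ)(a) = ρ(φ(a))`. [folklore] -/
@[simp] theorem embAct_apply (ρ : galoisClosure E →ₐ[ℚ] ℂ) (φ : Emb E) (a : E) :
    embAct ρ φ a = ρ (corestrict E φ a) := rfl

/-- The inclusion `E^c ⊂ ℂ` acts trivially. [folklore] -/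
theorem embAct_val (φ : Emb E) : embAct (galoisClosure E).val φ = φ := by
  ext a; rfl

/-- Each `ρ` acts injectively on `Hom(E, ℂ)` (`ρ` is injective). [folklore] -/
theorem embAct_injective (ρ : galoisClosure E →ₐ[ℚ] ℂ) : Function.Injective (embAct ρ) := by
  intro φ ψ h
  ext a
  have h1 : ρ (corestrict E φ a) = ρ (corestrict E ψ a) := by
    rw [← embAct_apply, ← embAct_apply, h]
  have h2 : corestrict E φ a = corestrict E ψ a := ρ.toRingHom.injective h1
  simpa using congrArg (fun z : galoisClosure E => (z : ℂ)) h2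

/-- An embedding `ρ : E^c → ℂ` maps `E^c` into itself (it permutes the generators `φ(a)`). [folklore] -/
theorem embedding_mem_galoisClosure (ρ : galoisClosure E →ₐ[ℚ] ℂ) (x : galoisClosure E) :
    ρ x ∈ galoisClosure E := by
  obtain ⟨x, hx⟩ := x
  induction hx using IntermediateField.adjoin_induction with
  | mem z hz =>
    obtain ⟨φ, ⟨a, rfl⟩⟩ := Set.mem_iUnion.mp hz
    have : ρ ⟨φ a, IntermediateField.subset_adjoin ℚ _ hz⟩ = embAct ρ φ a := rfl
    rw [this]
    exact range_subset_galoisClosure E (embAct ρ φ) ⟨a, rfl⟩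
  | algebraMap q =>
    have : (⟨algebraMap ℚ ℂ q, IntermediateField.algebraMap_mem _ q⟩ : galoisClosure E) =
        algebraMap ℚ (galoisClosure E) q := rfl
    rw [this, AlgHom.commutes]
    exact IntermediateField.algebraMap_mem _ q
  | add x y hx hy ihx ihy =>
    have : (⟨x + y, add_mem hx hy⟩ : galoisClosure E) = ⟨x, hx⟩ + ⟨y, hy⟩ := rfl
    rw [this, map_add]
    exact add_mem ihx ihy
  | inv x hx ihx =>
    have : (⟨x⁻¹, inv_mem hx⟩ : galoisClosure E) = (⟨x, hx⟩ : galoisClosure E)⁻¹ := rfl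
    rw [this, map_inv₀]
    exact inv_mem ihx
  | mul x y hx hy ihx ihy =>
    have : (⟨x * y, mul_mem hx hy⟩ : galoisClosure E) = ⟨x, hx⟩ * ⟨y, hy⟩ := rfl
    rw [this, map_mul]
    exact mul_mem ihx ihy

/-- The restriction of `ρ` to an endomorphism of `E^c`. [folklore] -/
def restrictEmb (ρ : galoisClosure E →ₐ[ℚ] ℂ) : galoisClosure E →ₐ[ℚ] galoisClosure E :=
  AlgHom.codRestrict ρ (galoisClosure E).toSubalgebra (embedding_mem_galoisClosure ρ)

/-- `restrictEmb ρ` has the values of `ρ`. [folklore] -/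
@[simp] theorem coe_restrictEmb_apply (ρ : galoisClosure E →ₐ[ℚ] ℂ) (x : galoisClosure E) :
    (restrictEmb ρ x : ℂ) = ρ x := rfl

end EmbAct

section Closure

variable {E : Type} [CommRing E] [Algebra ℚ E] [Module.Finite ℚ E]

/-- `φ(E)` lies in the field generated by the finitely many `ψ(b_m)`, `b_m` a `ℚ`-basis of `E`. [folklore] -/
theorem range_subset_adjoin_finite (φ : Emb E) :
    Set.range φ ⊆ (IntermediateField.adjoin ℚ
      (⋃ ψ : Emb E, ψ '' Set.range (Module.finBasis ℚ E)) : Set ℂ) := by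
  rintro _ ⟨a, rfl⟩
  set b := Module.finBasis ℚ E
  have ha : a = ∑ m, b.repr a m • b m := (b.sum_repr a).symm
  rw [ha, map_sum]
  refine Subalgebra.sum_mem _ fun m _ => ?_
  rw [map_smul]
  refine Subalgebra.smul_mem _ ?_ _
  apply IntermediateField.subset_adjoin
  exact Set.mem_iUnion.mpr ⟨φ, ⟨b m, ⟨m, rfl⟩, rfl⟩⟩

/-- `E^c ⊆ ℚ(ψ(b_m) : ψ, m)`. [folklore] -/
theorem galoisClosure_le_adjoin_finite :
    galoisClosure E ≤ IntermediateField.adjoin ℚ (⋃ ψ : Emb E, ψ '' Set.range (Module.finBasis ℚ E)) := by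
  rw [galoisClosure, IntermediateField.adjoin_le_iff]
  intro z hz
  obtain ⟨φ, hφ⟩ := Set.mem_iUnion.mp hz
  exact range_subset_adjoin_finite φ hφ

/-- `E^c` is a number field (§2.1: the composite of the Galois closures of the CM fields `E_j`; here: generated over
`ℚ` by finitely many algebraic numbers). [cite: GaoUllmo2025, §2.1] -/
instance finiteDimensional_galoisClosure : FiniteDimensional ℚ (galoisClosure E) := by
  have hfin : (⋃ ψ : Emb E, ψ '' Set.range (Module.finBasis ℚ E)).Finite :=
    Set.finite_iUnion fun ψ => (Set.finite_range _).image _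
  haveI := hfin.to_subtype
  haveI : FiniteDimensional ℚ
      (IntermediateField.adjoin ℚ (⋃ ψ : Emb E, ψ '' Set.range (Module.finBasis ℚ E))) := by
    apply IntermediateField.finiteDimensional_adjoin
    rintro _ ⟨_, ⟨ψ, rfl⟩, ⟨a, -, rfl⟩⟩
    exact (Algebra.IsIntegral.isIntegral (R := ℚ) a).map ψ
  exact FiniteDimensional.of_injective
    (IntermediateField.inclusion galoisClosure_le_adjoin_finite).toLinearMap
    (fun x y hxy => (IntermediateField.inclusion galoisClosure_le_adjoin_finite).injective hxy)

/-- The automorphism `σ_ρ ∈ Gal(E^c/ℚ)` induced by an embedding `ρ : E^c → ℂ` (an injective endomorphism of a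
number field is bijective). [folklore] -/
def autOfEmb (ρ : galoisClosure E →ₐ[ℚ] ℂ) : galoisClosure E ≃ₐ[ℚ] galoisClosure E :=
  AlgEquiv.ofBijective (restrictEmb ρ) (Algebra.IsAlgebraic.algHom_bijective _)

/-- `σ_ρ · φ = ρ ∘ φ`: the printed action of `σ ∈ G` on `Hom(E, ℂ)` is the action of the embedding `ρ = ι ∘ σ`.
[folklore] -/
theorem galAct_autOfEmb (ρ : galoisClosure E →ₐ[ℚ] ℂ) (φ : Emb E) : galAct E (autOfEmb ρ) φ = embAct ρ φ := by
  ext a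
  rw [galAct_apply, embAct_apply]
  rfl

/-- Each `ρ` permutes the finite set `Hom(E, ℂ)`. [folklore] -/
theorem embAct_bijective (ρ : galoisClosure E →ₐ[ℚ] ℂ) : Function.Bijective (embAct ρ) :=
  (Finite.injective_iff_bijective).mp (embAct_injective ρ)

end Closure

end Literature.AlgebraicGeometry.GaoUllmo2025

end
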